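import Literature.MathematicalPhysics.QuantumLattice.TwistEaterIrreducibility
import HarnessLib

/-!
# 't Hooft's colour-momentum basis as a `Basis`: `{A^a B^b}` of `gl(N, ℂ)`, its Hilbert–Schmidt coordinates, and the
# traceless basis `{A^a B^b : (a,b) ≠ (0,0)}` of `sl(N, ℂ)` on which `Ad A`, `Ad B` are diagonal

Topic `Literature/MathematicalPhysics/QuantumLattice`; namespace `Literature.MathematicalPhysics.QuantumLattice.TwistEaterBasis`.
Sibling of `TwistEaterIrreducibility.lean` §5–§6 (`linearIndependent_pow_mul_pow`, `span_pow_mul_pow_eq_top`,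
`trace_conjTranspose_pow_mul_pow_mul`, `trace_pow_mul_pow`, `conj_pow_mul_pow_eq_smul`), which this file only PACKAGES as Mathlib
`Basis` objects with explicit coordinates.  Two definitions (the two bases), everything else proved; no named facts, no `sorry`.

SETTING.  `A, B ∈ M_N(ℂ)` invertible with `A B = ω · B A`, `ω` a primitive `N`-th root of unity (a twist-eating ∕ Weyl–'t Hooft pair;
unitary where coordinates are given by Hilbert–Schmidt pairings).

RESULTS.
* `powMulPowBasis hA hB hω hAB : Basis (Fin N × Fin N) ℂ (Matrix (Fin N) (Fin N) ℂ)`, `powMulPowBasis_apply` (`= A^a B^b`)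
  — González-Arroyo 1998 §4.3 Thm 1 «the `N²` matrices … are linearly independent … they form a basis»;
* ★ `powMulPowBasis_repr` — for a UNITARY pair the coordinates are `c_{ab}(X) = N⁻¹ tr((A^aB^b)ᴴ X)` (Hilbert–Schmidt orthogonality,
  GPGAO 2014 §2); `trace_eq_card_mul_repr_zero` (`tr X = N · c_{00}(X)`), `repr_zero_eq_zero_iff` (`c_{00}(X) = 0 ↔ tr X = 0`);
* ★ `mem_span_pow_mul_pow_ne_zero_iff` — `X ∈ span{A^aB^b : (a,b) ≠ (0,0)} ↔ tr X = 0` («dropping `(0,0)`, a basis of `sl(N,ℂ)`»);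
* ★★ `tracelessPowMulPowBasis hA hB hω hAB : Basis {p : Fin N × Fin N // p ≠ (0,0)} ℂ ↥(ker tr)`, `coe_tracelessPowMulPowBasis`
  (`= A^a B^b`), and the diagonal ADJOINT ACTION on it for a unitary pair: `conj_tracelessPowMulPowBasis_fst`
  (`A e_{ab} Aᴴ = ω^b e_{ab}`), `conj_tracelessPowMulPowBasis_snd` (`B e_{ab} Bᴴ = ω^{−a} e_{ab}`) — colour momentum
  (GPGAO 2017 §2.3: «`Γ_μ χ(q) Γ_μ† = e^{iL_μq_μ} χ(q)` … `(N² − 1)` traceless linearly independent solutions»).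

WHY (cell `ym-ir`, row 43, K31).  This is the block-label factor `σ = {p ≠ 0}` of the adapted basis in
`LinearAlgebra/AdaptedBasisBlockDeterminant.lean`: tensored with the sites (`Pi.basis`) it diagonalises the complex covariant
Laplacian at the twist-eating ladder into the scalar twisted torus Laplacians of `Analysis/Matrix/TwistedCycleLaplacian.lean`
with phases `(ω^b, ω^{−a}, 1, 1)`.

HONEST SCOPE: finite-dimensional linear algebra (Stone–von Neumann for `ℤ/N`); nothing here bears on the Yang–Mills mass gap
(Clay: NOT proved); `R4` closes only the conditional finite-`𝕋⁴` rung `BalabanLadder.UV`.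

## References
* A. González-Arroyo, *Yang–Mills fields on the four-dimensional torus. Part 1: Classical theory*, hep-th/9807108, §4.3
  Thm 1 (corpus `paper:arxiv-hep-th_9807108` p0007). [Gonzalezarroyo1998]
* M. García Pérez, A. González-Arroyo, M. Okawa, IJMPA 29 (2014) 1445001, §2 (colour momentum, orthogonality).
  [GarciaperezGonzalezarroyoOkawa2014]
* M. García Pérez, A. González-Arroyo, M. Okawa, JHEP 10 (2017) 150, §2.3 (corpus `paper:arxiv-1708.00841` p0006).
  [GarciaperezGonzalezarroyoOkawa2017]
-/

noncomputable section

open scoped Matrix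

namespace Literature.MathematicalPhysics.QuantumLattice.TwistEaterBasis

open Module Literature.MathematicalPhysics.QuantumLattice

variable {N : ℕ} [NeZero N] {A B : Matrix (Fin N) (Fin N) ℂ} {ω : ℂ}

/-! ## §1 The full basis of `gl(N, ℂ)` -/

/-- **'t Hooft's matrix basis** `e_{(a,b)} = A^a B^b`, `a, b < N`, of the complex `N × N` matrices, for an invertible pair with
`A B = ω·B A`, `ω` a primitive `N`-th root of unity. [cite: Gonzalezarroyo1998, §4.3 Thm 1] -/
def powMulPowBasis (hA : IsUnit A) (hB : IsUnit B) (hω : IsPrimitiveRoot ω N) (hAB : A * B = ω • (B * A)) :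
    Basis (Fin N × Fin N) ℂ (Matrix (Fin N) (Fin N) ℂ) :=
  Basis.mk (linearIndependent_pow_mul_pow hA hB hω hAB) (by rw [span_pow_mul_pow_eq_top hA hB hω hAB])

/-- `e_{(a,b)} = A^a B^b`. [cite: Gonzalezarroyo1998, §4.3 Thm 1] -/
@[simp] theorem powMulPowBasis_apply (hA : IsUnit A) (hB : IsUnit B) (hω : IsPrimitiveRoot ω N)
    (hAB : A * B = ω • (B * A)) (p : Fin N × Fin N) :
    powMulPowBasis hA hB hω hAB p = A ^ (p.1 : ℕ) * B ^ (p.2 : ℕ) := by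
  rw [powMulPowBasis, Basis.mk_apply]

/-- **The trace sees only the `(0,0)` coordinate**: `tr X = N · c_{00}(X)`. [cite: Gonzalezarroyo1998, §4.3 (traces of the `Γ(n)`)] -/
theorem trace_eq_card_mul_repr_zero (hA : IsUnit A) (hB : IsUnit B) (hω : IsPrimitiveRoot ω N)
    (hAB : A * B = ω • (B * A)) (X : Matrix (Fin N) (Fin N) ℂ) :
    X.trace = (N : ℂ) * (powMulPowBasis hA hB hω hAB).repr X (0, 0) := by
  classical
  set e := powMulPowBasis hA hB hω hAB with he
  conv_lhs => rw [← e.sum_repr X]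
  rw [Matrix.trace_sum]
  have h : ∀ p : Fin N × Fin N, (e.repr X p • e p).trace = if p = (0, 0) then (N : ℂ) * e.repr X (0, 0) else 0 := by
    intro p
    rw [Matrix.trace_smul, he, powMulPowBasis_apply, trace_pow_mul_pow hA hB hω hAB p, smul_eq_mul]
    by_cases hp : p = (0, 0)
    · subst hp; simp [mul_comm]
    · simp [hp]
  simp_rw [h]
  rw [Finset.sum_ite_eq', if_pos (Finset.mem_univ _)]

/-- `c_{00}(X) = 0 ↔ tr X = 0`. [cite: Gonzalezarroyo1998, §4.3] -/
theorem repr_zero_eq_zero_iff (hA : IsUnit A) (hB : IsUnit B) (hω : IsPrimitiveRoot ω N)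
    (hAB : A * B = ω • (B * A)) (X : Matrix (Fin N) (Fin N) ℂ) :
    (powMulPowBasis hA hB hω hAB).repr X (0, 0) = 0 ↔ X.trace = 0 := by
  rw [trace_eq_card_mul_repr_zero hA hB hω hAB X, mul_eq_zero, or_iff_right (Nat.cast_ne_zero.2 (NeZero.ne N))]

/-- ★ **Hilbert–Schmidt coordinates for a unitary pair**: `c_{(a,b)}(X) = N⁻¹ · tr((A^aB^b)ᴴ X)`.
[cite: GarciaperezGonzalezarroyoOkawa2014, §2] [cite: Gonzalezarroyo1998, §4.3 Thm 1] -/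
theorem powMulPowBasis_repr (hAu : A ∈ Matrix.unitaryGroup (Fin N) ℂ) (hBu : B ∈ Matrix.unitaryGroup (Fin N) ℂ)
    (hω : IsPrimitiveRoot ω N) (hAB : A * B = ω • (B * A)) (X : Matrix (Fin N) (Fin N) ℂ) (p : Fin N × Fin N) :
    (powMulPowBasis ⟨⟨A, star A, hAu.2, hAu.1⟩, rfl⟩ ⟨⟨B, star B, hBu.2, hBu.1⟩, rfl⟩ hω hAB).repr X p =
      (N : ℂ)⁻¹ * ((A ^ (p.1 : ℕ) * B ^ (p.2 : ℕ))ᴴ * X).trace := by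
  classical
  set e := powMulPowBasis ⟨⟨A, star A, hAu.2, hAu.1⟩, rfl⟩ ⟨⟨B, star B, hBu.2, hBu.1⟩, rfl⟩ hω hAB with he
  have hX : ((A ^ (p.1 : ℕ) * B ^ (p.2 : ℕ))ᴴ * X).trace = (N : ℂ) * e.repr X p := by
    conv_lhs => rw [← e.sum_repr X]
    rw [Matrix.mul_sum, Matrix.trace_sum]
    have h : ∀ q : Fin N × Fin N, ((A ^ (p.1 : ℕ) * B ^ (p.2 : ℕ))ᴴ * (e.repr X q • e q)).trace =
        if p = q then (N : ℂ) * e.repr X p else 0 := by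
      intro q
      rw [Matrix.mul_smul, Matrix.trace_smul, he, powMulPowBasis_apply, smul_eq_mul,
        trace_conjTranspose_pow_mul_pow_mul hAu hBu hω hAB p.1 p.2 q.1 q.2]
      by_cases hq : p = q
      · subst hq; simp [mul_comm]
      · have hq' : (p.1, p.2) ≠ (q.1, q.2) := by rwa [Prod.mk.eta, Prod.mk.eta]
        rw [if_neg hq', if_neg hq, mul_zero]
    simp_rw [h]
    rw [Finset.sum_ite_eq, if_pos (Finset.mem_univ _)]
  rw [hX, ← mul_assoc, inv_mul_cancel₀ (Nat.cast_ne_zero.2 (NeZero.ne N)), one_mul]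

/-! ## §2 The traceless basis of `sl(N, ℂ)` and the diagonal adjoint action -/

/-- ★ **`span{A^aB^b : (a,b) ≠ (0,0)} = sl(N, ℂ)`**: a matrix lies in the span of the non-trivial monomials iff it is traceless.
[cite: Gonzalezarroyo1998, §4.3 Thm 1 («dropping `(0,0)`, of `sl(N,ℂ)`»)] [cite: GarciaperezGonzalezarroyoOkawa2017, §2.3 («`(N²−1)` traceless linearly independent solutions»)] -/
theorem mem_span_pow_mul_pow_ne_zero_iff (hA : IsUnit A) (hB : IsUnit B) (hω : IsPrimitiveRoot ω N)
    (hAB : A * B = ω • (B * A)) (X : Matrix (Fin N) (Fin N) ℂ) :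
    X ∈ Submodule.span ℂ (Set.range fun p : {p : Fin N × Fin N // p ≠ (0, 0)} => A ^ (p.1.1 : ℕ) * B ^ (p.1.2 : ℕ)) ↔
      X.trace = 0 := by
  classical
  constructor
  · intro hX
    refine Submodule.span_induction (p := fun Y _ => Y.trace = 0) ?_ ?_ ?_ ?_ hX
    · rintro _ ⟨p, rfl⟩
      rw [trace_pow_mul_pow hA hB hω hAB p.1, if_neg p.2]
    · exact Matrix.trace_zero _ _
    · intro Y Z _ _ hY hZ
      rw [Matrix.trace_add, hY, hZ, add_zero]
    · intro c Y _ hY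
      rw [Matrix.trace_smul, hY, smul_zero]
  · intro hX
    set e := powMulPowBasis hA hB hω hAB with he
    have h0 : e.repr X (0, 0) = 0 := (repr_zero_eq_zero_iff hA hB hω hAB X).2 hX
    rw [← e.sum_repr X]
    refine Submodule.sum_mem _ fun p _ => ?_
    by_cases hp : p = (0, 0)
    · rw [hp, h0, zero_smul]
      exact Submodule.zero_mem _
    · refine Submodule.smul_mem _ _ (Submodule.subset_span ⟨⟨p, hp⟩, ?_⟩)
      rw [he, powMulPowBasis_apply]

/-- The non-trivial monomials are linearly independent (a sub-family of 't Hooft's basis). [cite: Gonzalezarroyo1998, §4.3 Thm 1] -/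
theorem linearIndependent_pow_mul_pow_ne_zero (hA : IsUnit A) (hB : IsUnit B) (hω : IsPrimitiveRoot ω N)
    (hAB : A * B = ω • (B * A)) :
    LinearIndependent ℂ (fun p : {p : Fin N × Fin N // p ≠ (0, 0)} => A ^ (p.1.1 : ℕ) * B ^ (p.1.2 : ℕ)) :=
  (linearIndependent_pow_mul_pow hA hB hω hAB).comp (fun p : {p : Fin N × Fin N // p ≠ (0, 0)} => p.1)
    Subtype.val_injective

/-- `span{A^aB^b : (a,b) ≠ (0,0)} = ker tr` as submodules. [cite: Gonzalezarroyo1998, §4.3 Thm 1] -/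
theorem span_pow_mul_pow_ne_zero_eq_ker (hA : IsUnit A) (hB : IsUnit B) (hω : IsPrimitiveRoot ω N)
    (hAB : A * B = ω • (B * A)) :
    Submodule.span ℂ (Set.range fun p : {p : Fin N × Fin N // p ≠ (0, 0)} => A ^ (p.1.1 : ℕ) * B ^ (p.1.2 : ℕ)) =
      LinearMap.ker (Matrix.traceLinearMap (Fin N) ℂ ℂ) := by
  ext X
  rw [mem_span_pow_mul_pow_ne_zero_iff hA hB hω hAB, LinearMap.mem_ker, Matrix.traceLinearMap_apply]

/-- ★★ **'t Hooft's traceless basis** `{A^aB^b : (a,b) ≠ (0,0)}` of `sl(N, ℂ) = ker tr`. [cite: Gonzalezarroyo1998, §4.3 Thm 1]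
[cite: GarciaperezGonzalezarroyoOkawa2017, §2.3] -/
def tracelessPowMulPowBasis (hA : IsUnit A) (hB : IsUnit B) (hω : IsPrimitiveRoot ω N) (hAB : A * B = ω • (B * A)) :
    Basis {p : Fin N × Fin N // p ≠ (0, 0)} ℂ (LinearMap.ker (Matrix.traceLinearMap (Fin N) ℂ ℂ)) :=
  (Basis.span (linearIndependent_pow_mul_pow_ne_zero hA hB hω hAB)).map
    (LinearEquiv.ofEq _ _ (span_pow_mul_pow_ne_zero_eq_ker hA hB hω hAB))

/-- `e_{(a,b)} = A^a B^b` as a matrix. [cite: Gonzalezarroyo1998, §4.3 Thm 1] -/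
@[simp] theorem coe_tracelessPowMulPowBasis (hA : IsUnit A) (hB : IsUnit B) (hω : IsPrimitiveRoot ω N)
    (hAB : A * B = ω • (B * A)) (p : {p : Fin N × Fin N // p ≠ (0, 0)}) :
    ((tracelessPowMulPowBasis hA hB hω hAB p : LinearMap.ker (Matrix.traceLinearMap (Fin N) ℂ ℂ)) :
      Matrix (Fin N) (Fin N) ℂ) = A ^ (p.1.1 : ℕ) * B ^ (p.1.2 : ℕ) := by
  rw [tracelessPowMulPowBasis, Basis.map_apply, LinearEquiv.coe_ofEq_apply, Basis.span_apply]

/-- `dim sl(N, ℂ) = N² − 1` in the form `#{p ≠ (0,0)}`. [cite: GarciaperezGonzalezarroyoOkawa2017, §2.3 («`(N²−1)` … solutions»)] -/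
theorem finrank_ker_trace_eq (hA : IsUnit A) (hB : IsUnit B) (hω : IsPrimitiveRoot ω N) (hAB : A * B = ω • (B * A)) :
    Module.finrank ℂ (LinearMap.ker (Matrix.traceLinearMap (Fin N) ℂ ℂ)) = N * N - 1 := by
  classical
  rw [Module.finrank_eq_card_basis (tracelessPowMulPowBasis hA hB hω hAB), Fintype.card_subtype_compl,
    Fintype.card_prod, Fintype.card_fin, Fintype.card_unique]

/-- ★ **Colour momentum under `Ad A`**: `A e_{(a,b)} Aᴴ = ω^b · e_{(a,b)}` on the traceless basis (unitary `A`).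
[cite: GarciaperezGonzalezarroyoOkawa2017, §2.3 (`Γ_μ χ Γ_μ† = e^{iL_μq_μ} χ`)] [cite: GarciaperezGonzalezarroyoOkawa2014, §2] -/
theorem conj_tracelessPowMulPowBasis_fst (hA : IsUnit A) (hB : IsUnit B) (hω : IsPrimitiveRoot ω N)
    (hAB : A * B = ω • (B * A)) (hAu : A * Aᴴ = 1) (p : {p : Fin N × Fin N // p ≠ (0, 0)}) :
    A * ((tracelessPowMulPowBasis hA hB hω hAB p : LinearMap.ker (Matrix.traceLinearMap (Fin N) ℂ ℂ)) :
      Matrix (Fin N) (Fin N) ℂ) * Aᴴ = ω ^ (p.1.2 : ℕ) • ((tracelessPowMulPowBasis hA hB hω hAB p :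
        LinearMap.ker (Matrix.traceLinearMap (Fin N) ℂ ℂ)) : Matrix (Fin N) (Fin N) ℂ) := by
  rw [coe_tracelessPowMulPowBasis]
  exact mul_pow_mul_pow_mul_conjTranspose hAB hAu _ _

/-- ★ **Colour momentum under `Ad B`**: `B e_{(a,b)} Bᴴ = ω^{−a} · e_{(a,b)}` (unitary `B`).
[cite: GarciaperezGonzalezarroyoOkawa2017, §2.3] [cite: GarciaperezGonzalezarroyoOkawa2014, §2] -/
theorem conj_tracelessPowMulPowBasis_snd (hA : IsUnit A) (hB : IsUnit B) (hω : IsPrimitiveRoot ω N)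
    (hAB : A * B = ω • (B * A)) (hBu : B * Bᴴ = 1) (p : {p : Fin N × Fin N // p ≠ (0, 0)}) :
    B * ((tracelessPowMulPowBasis hA hB hω hAB p : LinearMap.ker (Matrix.traceLinearMap (Fin N) ℂ ℂ)) :
      Matrix (Fin N) (Fin N) ℂ) * Bᴴ = (ω ^ (p.1.1 : ℕ))⁻¹ • ((tracelessPowMulPowBasis hA hB hω hAB p :
        LinearMap.ker (Matrix.traceLinearMap (Fin N) ℂ ℂ)) : Matrix (Fin N) (Fin N) ℂ) := by
  rw [coe_tracelessPowMulPowBasis]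
  exact conj_pow_mul_pow_eq_smul hAB hBu (fun a => pow_ne_zero _ (hω.ne_zero (NeZero.ne N))) _ _

/-- The same two relations on the full basis. [cite: GarciaperezGonzalezarroyoOkawa2014, §2] -/
theorem conj_powMulPowBasis_fst (hA : IsUnit A) (hB : IsUnit B) (hω : IsPrimitiveRoot ω N)
    (hAB : A * B = ω • (B * A)) (hAu : A * Aᴴ = 1) (p : Fin N × Fin N) :
    A * powMulPowBasis hA hB hω hAB p * Aᴴ = ω ^ (p.2 : ℕ) • powMulPowBasis hA hB hω hAB p := by
  rw [powMulPowBasis_apply]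
  exact mul_pow_mul_pow_mul_conjTranspose hAB hAu _ _

/-- … and for `B`. [cite: GarciaperezGonzalezarroyoOkawa2014, §2] -/
theorem conj_powMulPowBasis_snd (hA : IsUnit A) (hB : IsUnit B) (hω : IsPrimitiveRoot ω N)
    (hAB : A * B = ω • (B * A)) (hBu : B * Bᴴ = 1) (p : Fin N × Fin N) :
    B * powMulPowBasis hA hB hω hAB p * Bᴴ = (ω ^ (p.1 : ℕ))⁻¹ • powMulPowBasis hA hB hω hAB p := by
  rw [powMulPowBasis_apply]
  exact conj_pow_mul_pow_eq_smul hAB hBu (fun a => pow_ne_zero _ (hω.ne_zero (NeZero.ne N))) _ _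

end Literature.MathematicalPhysics.QuantumLattice.TwistEaterBasis

end
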